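import Summits.Parity.GeneralizedHardyLittlewood.Theses.LiouvilleShiftedTables

/-!
# `TableChowla` (stmt-Parity-14270) is FALSE without the hypothesis `c ≠ 0`

Negative lemma for the crux `LiouvilleShiftedTables.TableChowla` (load-bearing analysis by the
cdisprove seat): at the shift `c = 0` the Liouville multiplication table is RANK ONE,
`λ(ab) = λ(a)λ(b)`, so its fourth moment is `rows² · B² = x²` exactly (no cancellation), while the
crux shape claims `≤ x²/(log x)^C`. Hence any proof of the crux must use `c ≠ 0`. Self-contained copy
of the relevant part of the crux work file `Cruxes/TableChowla/Disproof.lean` (which files under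
`Theorems/` may not import). [folklore]
-/

namespace Summit.Parity.GeneralizedHardyLittlewood.Theorems.TableChowla.Negative

open Finset Real ArithmeticFunction
open Summit.Parity.GeneralizedHardyLittlewood.Theses

noncomputable section

/-- Liouville's function cast to `ℝ` (`λ 0 = 0`). -/
def lam (n : ℕ) : ℝ := (ArithmeticFunction.liouville n : ℝ)

/-- Row correlation `S_f(a,a') = ∑_{b ≤ B} f(ab+c) f(a'b+c)` of the shifted multiplication table. -/
def rowCorr (f : ℕ → ℝ) (c : ℤ) (B a a' : ℕ) : ℝ :=
  ∑ b ∈ Icc 1 B, f (Int.toNat ((a : ℤ) * b + c)) * f (Int.toNat ((a' : ℤ) * b + c))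

/-- Fourth moment `tr (M Mᵀ)²` of the table with rows `Ioc A₁ A₂`, columns `Icc 1 B`. -/
def momentN (f : ℕ → ℝ) (c : ℤ) (A₁ A₂ B : ℕ) : ℝ :=
  ∑ a ∈ Ioc A₁ A₂, ∑ a' ∈ Ioc A₁ A₂, rowCorr f c B a a' ^ 2

/-- The crux's real-parameter moment: rows `(⌊A⌋, ⌊2A⌋]`, columns `[1, ⌊x/A⌋]`. -/
def moment (f : ℕ → ℝ) (c : ℤ) (x A : ℝ) : ℝ := momentN f c ⌊A⌋₊ ⌊2 * A⌋₊ ⌊x / A⌋₊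

variable {f : ℕ → ℝ} {c : ℤ} {A₁ A₂ B : ℕ}

/-- RANK-ONE COLLAPSE: if the table factorises as `u(a) v(b)` then
`tr (M Mᵀ)² = (∑ u²)² (∑ v²)²` — no cancellation whatsoever. -/
theorem momentN_of_rankOne (u v : ℕ → ℝ)
    (h : ∀ a ∈ Ioc A₁ A₂, ∀ b ∈ Icc 1 B, f (Int.toNat ((a : ℤ) * b + c)) = u a * v b) :
    momentN f c A₁ A₂ B = (∑ a ∈ Ioc A₁ A₂, u a ^ 2) ^ 2 * (∑ b ∈ Icc 1 B, v b ^ 2) ^ 2 := by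
  have hrow : ∀ a ∈ Ioc A₁ A₂, ∀ a' ∈ Ioc A₁ A₂,
      rowCorr f c B a a' = u a * u a' * ∑ b ∈ Icc 1 B, v b ^ 2 := by
    intro a ha a' ha'
    unfold rowCorr
    rw [mul_sum]
    refine sum_congr rfl fun b hb => ?_
    rw [h a ha b hb, h a' ha' b hb]
    ring
  unfold momentN
  calc ∑ a ∈ Ioc A₁ A₂, ∑ a' ∈ Ioc A₁ A₂, rowCorr f c B a a' ^ 2
        = ∑ a ∈ Ioc A₁ A₂, ∑ a' ∈ Ioc A₁ A₂,
            u a ^ 2 * u a' ^ 2 * (∑ b ∈ Icc 1 B, v b ^ 2) ^ 2 := by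
          refine sum_congr rfl fun a ha => sum_congr rfl fun a' ha' => ?_
          rw [hrow a ha a' ha']
          ring
    _ = (∑ a ∈ Ioc A₁ A₂, u a ^ 2) ^ 2 * (∑ b ∈ Icc 1 B, v b ^ 2) ^ 2 := by
          rw [sq (∑ a ∈ Ioc A₁ A₂, u a ^ 2), sum_mul_sum, sum_mul]
          refine sum_congr rfl fun a _ => ?_
          rw [sum_mul]

/-- `λ(n)² = 1` for `n ≥ 1`. -/
theorem lam_sq {n : ℕ} (hn : n ≠ 0) : lam n ^ 2 = 1 := by
  unfold lam
  rw [liouville_apply hn]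
  push_cast
  rw [← pow_mul, mul_comm, pow_mul]
  norm_num

/-- Complete multiplicativity of `λ` (over `ℝ`). -/
theorem lam_mul (m n : ℕ) : lam (m * n) = lam m * lam n := by
  unfold lam
  rw [liouville_apply_mul]
  push_cast
  ring

/-- `⌊2m⌋₊ = 2m`. -/
theorem floor_two_mul_natCast (m : ℕ) : ⌊2 * (m : ℝ)⌋₊ = 2 * m := by
  rw [show (2 * (m : ℝ)) = ((2 * m : ℕ) : ℝ) by push_cast; ring, Nat.floor_natCast]

/-- At `x = m^k`, `A = m` (`k ≥ 1`, `m ≥ 1`) the crux's moment is the integer-parameter moment with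
rows `(m, 2m]` and `m^(k-1)` columns. -/
theorem moment_pow (f : ℕ → ℝ) (c : ℤ) {k m : ℕ} (hk : 1 ≤ k) (hm : m ≠ 0) :
    moment f c ((m : ℝ) ^ k) m = momentN f c m (2 * m) (m ^ (k - 1)) := by
  unfold moment
  rw [Nat.floor_natCast, floor_two_mul_natCast]
  congr 1
  have hm' : (m : ℝ) ≠ 0 := by exact_mod_cast hm
  have hpow : (m : ℝ) ^ k = (m : ℝ) ^ (k - 1) * m := by
    rw [← pow_succ, Nat.sub_add_cancel hk]
  rw [hpow, mul_div_cancel_right₀ _ hm', show ((m : ℝ) ^ (k - 1)) = ((m ^ (k - 1) : ℕ) : ℝ) by push_cast; rfl,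
    Nat.floor_natCast]

/-- `(m^k)^(1/k) = m`. -/
theorem rpow_pow_one_div (k : ℕ) (hk : k ≠ 0) (m : ℕ) : ((m : ℝ) ^ k) ^ ((1 : ℝ) / k) = m := by
  rw [one_div]
  exact Real.pow_rpow_inv_natCast (Nat.cast_nonneg m) hk

/-- Window check at `x = m^k`, `A = m`, `δ = 1/k`: `x^δ ≤ A ≤ x^(1/3+δ)`. -/
theorem window_pow {k : ℕ} (hk : k ≠ 0) {m : ℕ} (hm : 1 ≤ m) :
    ((m : ℝ) ^ k) ^ ((1 : ℝ) / k) ≤ m ∧ (m : ℝ) ≤ ((m : ℝ) ^ k) ^ ((1 : ℝ) / 3 + 1 / k) := by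
  have hlow := rpow_pow_one_div k hk m
  refine ⟨hlow.le, ?_⟩
  have hm1 : (1 : ℝ) ≤ m := by exact_mod_cast hm
  have hx1 : (1 : ℝ) ≤ (m : ℝ) ^ k := one_le_pow₀ hm1
  calc (m : ℝ) = ((m : ℝ) ^ k) ^ ((1 : ℝ) / k) := hlow.symm
    _ ≤ ((m : ℝ) ^ k) ^ ((1 : ℝ) / 3 + 1 / k) :=
        Real.rpow_le_rpow_of_exponent_le hx1 (by linarith [show (0:ℝ) ≤ 1/3 by norm_num])

/-- Contradiction engine shared by the refutations: `P ≤ P'/L`, `P' ≤ κ P`, `0 < P`, `κ < L`. -/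
theorem absurd_of_le_div {P P' L κ : ℝ} (hP : 0 < P) (hP' : P' ≤ κ * P) (hκ : 0 ≤ κ) (hL : κ < L)
    (h : P ≤ P' / L) : False := by
  have hLpos : 0 < L := lt_of_le_of_lt hκ hL
  rw [le_div_iff₀ hLpos] at h
  nlinarith

/-- `log 2 > 1/2`. -/
theorem log_two_gt_half : (1 : ℝ) / 2 < Real.log 2 := by
  have := Real.log_two_gt_d9; linarith

/-- The crux with the hypothesis `c ≠ 0` dropped. -/
def TableChowlaWithoutShiftNeZero : Prop :=
  ∀ c : ℤ, ∀ δ : ℝ, 0 < δ → δ ≤ 1 / 12 → ∀ C : ℝ, 0 < C → ∃ x₀ : ℝ, ∀ x : ℝ, x₀ ≤ x →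
    ∀ A : ℝ, x ^ δ ≤ A → A ≤ x ^ (1 / 3 + δ) → moment lam c x A ≤ x ^ 2 / Real.log x ^ C

/-- At `c = 0` the λ-table is RANK ONE (`λ(ab) = λ(a)λ(b)`): the moment is `rows² · B²` exactly. -/
theorem momentN_lam_shift_zero (A₁ A₂ B : ℕ) :
    momentN lam 0 A₁ A₂ B = ((Ioc A₁ A₂).card : ℝ) ^ 2 * (B : ℝ) ^ 2 := by
  rw [momentN_of_rankOne (f := lam) (c := 0) lam lam ?_]
  · congr 2
    · rw [sum_congr rfl fun a ha => lam_sq (by simp only [mem_Ioc] at ha; omega)]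
      simp
    · rw [sum_congr rfl fun b hb => lam_sq (by simp only [mem_Icc] at hb; omega)]
      simp
  · intro a _ b _
    rw [add_zero, show ((a : ℤ) * (b : ℕ)) = ((a * b : ℕ) : ℤ) by push_cast; rfl, Int.toNat_natCast,
      lam_mul]

/-- `c ≠ 0` is load-bearing: at `c = 0` (`δ = 1/12`, `C = 1`, `x = m¹²`, `A = m`) the moment is
`m² · m²² = x²` while the claim is `≤ x² / (12 log m)`. -/
theorem not_tableChowlaWithoutShiftNeZero : ¬ TableChowlaWithoutShiftNeZero := by
  intro h
  obtain ⟨x₀, hx₀⟩ := h 0 (1 / 12) (by norm_num) le_rfl 1 one_pos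
  obtain ⟨m, hm⟩ := exists_nat_ge (max x₀ 2)
  have hm2 : (2 : ℝ) ≤ m := le_trans (le_max_right _ _) hm
  have hmx : x₀ ≤ m := le_trans (le_max_left _ _) hm
  have hm1 : (1 : ℝ) ≤ m := by linarith
  have hm1' : 1 ≤ m := by exact_mod_cast hm1
  have hm0 : m ≠ 0 := by omega
  have hxx₀ : x₀ ≤ (m : ℝ) ^ 12 := hmx.trans (le_self_pow₀ hm1 (by norm_num))
  obtain ⟨hw1, hw2⟩ := window_pow (k := 12) (by norm_num) hm1'
  have key := hx₀ ((m : ℝ) ^ 12) hxx₀ m (by exact_mod_cast hw1) (by exact_mod_cast hw2)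
  rw [moment_pow lam 0 (by norm_num) hm0, momentN_lam_shift_zero, Nat.card_Ioc, Real.rpow_one,
    Real.log_pow] at key
  -- key : (2m - m)² · (m¹¹)² ≤ (m¹²)² / (12 log m)
  have hP : (0 : ℝ) < ((2 * m - m : ℕ) : ℝ) ^ 2 * ((m ^ (12 - 1) : ℕ) : ℝ) ^ 2 := by
    have : ((2 * m - m : ℕ) : ℝ) = m := by rw [show 2 * m - m = m by omega]
    rw [this]; positivity
  refine absurd_of_le_div hP (κ := 1) ?_ zero_le_one ?_ key
  · rw [show 2 * m - m = m by omega]; push_cast; ring_nf; rfl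
  · have := Real.log_le_log (by norm_num) hm2
    have := log_two_gt_half
    push_cast
    linarith

end

end Summit.Parity.GeneralizedHardyLittlewood.Theorems.TableChowla.Negative
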